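import Summits.RiemannHypothesis.RiemannHypothesis.Theorems.Splittings.RobinFiniteSqrtWindowCover
import Summits.RiemannHypothesis.RiemannHypothesis.Theorems.Splittings.RobinFiniteReflLow
import HarnessLib

/-!
# RobinFiniteSqrtWindowRefl — gen 16 «Q-SCALE √-WINDOW LIFTS THE LEVEL BUDGETS», part R1/R2 (reflected): the lifted law with lane (ix-h)'s REFLECTION-PAIRED charge `tailH(T)·(√P + 1/√P)/2`

Cell rh-split, seat rh-split-robin-finite g16 (card `cards/SPLIT-robin-finite.md` §23).

THE LEVER (gen 16).  The landed cell certificates (`RobinAnalyticSharp.cover11 … cover17`, budgets `b₁₁ … b₁₇ = 0.105 … 0.50`) price the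
SECOND prime `Q` with Schoenfeld's RH-form relative error `δ(Q) = log²Q/(8π√Q)` two-sided.  Büthe 2018 Thm 2 (`Buthe2018_thm2_theta`,
already a hypothesis of every low-height row) gives the ONE-SIDED `√`-window `y − 1.95√y ≤ θ(y) ≤ y` (`1423 ≤ y ≤ 10¹⁹`):
`δ_l(Q) = 1.95/√Q`, `δ_u = 0`, `δ(P) ↦ 0`.  Re-certifying the SAME covers (`coverOKS`, `decide +kernel`) lifts the budgets to
`b'₁₁ … b'₁₇ = 0.208, 0.332, 0.405, 0.461, 0.504, 0.538, 0.564`; Büthe 2016 and the range condition drop out below `10¹⁹`.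
Rows (RH(T) in hypothesis position): `RH(10⁵) ⟹ robinCA_below 55 000 001`; `4¹³ ← RH(124 000)`, `4¹⁴ ← RH(212 000)`,
`4¹⁵ ← RH(364 000)`, `4¹⁶ ← RH(705 000)`, `4¹⁷ ← RH(1.4·10⁶)`, `4¹⁸ ← RH(2.65·10⁶)` (tree: —, 330 000, 500 000, 860 000, 1.62·10⁶, 3·10⁶).

HONEST LABEL: SPLITTING SEARCH over kernel-typed RH-EQUIVALENCES; a splitting A ∧ B ⟹ RH is CONDITIONAL
bookkeeping unless A and B are both proved; nothing here bears on the truth of RH.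

This part (1 `def`, 14 theorems): S7 `add_inv_mono_one`, `mertensProdLt_levelSR`, `mertensProdLt_lowSR`, `robinCA_below_lowSR`, `tolSR`, `levelSR_of_tol`, `robinCA_below_cellsSR`,
rows `robinCA_below_of_rh100000SR` (`4¹⁴`), `robinCA_below_483e6_of_rh100000R` (`483 000 001`), `robin_le_of_rh100000SR`, `robin_le_ten_pow_of_rh100000SR`
(`n ≤ 10^209 600 000`), `robinCA_below_of_rh{181000,325000,648000,1320000}SR` (`4¹⁵ … 4¹⁸`).  Depends on (ix-h) #1 `RobinFiniteRefl` and #3 `RobinFiniteReflLow`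
(`negLog_le_Eb_point_refl`) — NOT yet in the tree at the time of writing; fileable after them and after part 3/5.
-/

set_option linter.dupNamespace false

noncomputable section

open Real Filter Finset
open scoped Chebyshev

namespace Summit.RiemannHypothesis.RiemannHypothesis.Theorems.Splittings.RobinFiniteC1

open Literature.NumberTheory.LFunctions Literature.NumberTheory.DiophantineGeometry
open RobinAnalyticSharp RobinAnalyticSharp.Cells
open Summit.RiemannHypothesis.RiemannHypothesis.Theorems.Splittings.RobinFiniteE3

section SqrtWindowRefl

/-! ### S7 · the lifted law with the REFLECTION-PAIRED (halved) off-line charge of lane (ix-h)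
(`negLog_le_Eb_point_refl`: `tailH(T)·√P ↦ tailH(T)·(√P + 1/√P)/2`; budgets `b'_k`, key inequality `key_ineq_levelS`, window
`thetaWindow_ofB` — so NO Büthe 2016 and NO range condition; the top level may be partial) -/

/-- `a + a⁻¹ ≤ b + b⁻¹` for `1 ≤ a ≤ b`. -/
private theorem add_inv_mono_one {a b : ℝ} (ha : 1 ≤ a) (hab : a ≤ b) : a + a⁻¹ ≤ b + b⁻¹ := by
  have ha0 : 0 < a := by linarith
  have hb0 : 0 < b := by linarith
  rw [← sub_nonneg]
  have e : b + b⁻¹ - (a + a⁻¹) = (b - a) * (1 - 1 / (a * b)) := by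
    field_simp
    ring
  rw [e]
  refine mul_nonneg (by linarith) ?_
  rw [sub_nonneg, div_le_one (mul_pos ha0 hb0)]
  nlinarith

/-- **One level on the lifted budget with the HALVED charge, partial levels allowed**: the CA Mertens inequality for
`4ᵏ ≤ P ≤ 4ᵏ⁺¹`, `P ≤ Y`, `Q ≤ P` (`11 ≤ k ≤ 17`) at any `T ≥ 10⁵` with `RH(T)`, under
`0.0463 + (1 + 2/L1 k)·tailH(T)·(√Y + 1/√Y)/2 ≤ b'_k`. -/
theorem mertensProdLt_levelSR (hB : Buthe2018_thm2_theta) (hK : BroadbentEtAl2021_theta_rel_1e19)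
    {T : ℝ} (hT : 100000 ≤ T) (hRH : RiemannHypothesisUpTo T) {k : ℕ} (hk11 : 11 ≤ k) (hk17 : k ≤ 17) {Y : ℝ}
    (hlev : 0.0463 + (1 + 2 / ((L1 k : ℚ) : ℝ)) *
      (((Real.log (T / (2 * π)) + 1) / (π * T) + (184 + 30 * Real.log T) / T ^ 2) * ((√Y + (√Y)⁻¹) / 2)) ≤ ((bkS k : ℚ) : ℝ))
    {P Q : ℕ} (hPl : 4 ^ k ≤ P) (hPu : P ≤ 4 ^ (k + 1)) (hPY : (P : ℝ) ≤ Y) (hQP : Q ≤ P) :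
    (∏ p ∈ Nat.primesLE P, (1 - (p : ℝ)⁻¹))⁻¹ *
        ∏ p ∈ (Nat.primesLE P).filter (fun p => Q < p), (1 - ((p : ℝ) ^ 2)⁻¹) <
      rexp eulerMascheroniConstant * Real.log (θ P + θ Q) := by
  have hT7 : (7 : ℝ) ≤ T := by linarith
  have ht0 := Summit.RiemannHypothesis.RiemannHypothesis.Theorems.Splittings.RobinFiniteTail.tailH_nonneg hT7
  obtain ⟨hP₁599, hL₁, -, -, hL₁8, -, -⟩ := range_facts (k := k) (by omega)
  have hPr : (4 : ℝ) ^ k ≤ P := by exact_mod_cast hPl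
  have hPur : (P : ℝ) ≤ (4 : ℝ) ^ (k + 1) := by exact_mod_cast hPu
  have hP599 : (599 : ℝ) ≤ P := hP₁599.trans hPr
  have hP11 : 4 ^ 11 ≤ P := le_trans (Nat.pow_le_pow_right (by norm_num) hk11) hPl
  have hPB : (P : ℝ) ≤ (10 : ℝ) ^ 19 :=
    hPur.trans ((pow_le_pow_right₀ (by norm_num) (by omega : k + 1 ≤ 18)).trans (by norm_num))
  have hL₁0 : (0 : ℝ) < ((L1 k : ℚ) : ℝ) := by linarith
  have hW := thetaWindow_ofB hB
  have hlow := negLog_le_Eb_point_refl hB hK hT7 hRH hW hP599 hPB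
  have hlogP : ((L1 k : ℚ) : ℝ) ≤ Real.log P := hL₁.trans (Real.log_le_log (by positivity) hPr)
  have h2 : 2 / Real.log (P : ℝ) ≤ 2 / ((L1 k : ℚ) : ℝ) := div_le_div_of_nonneg_left (by norm_num) hL₁0 hlogP
  have h2' : (0 : ℝ) ≤ 2 / Real.log (P : ℝ) := div_nonneg (by norm_num) (hL₁0.le.trans hlogP)
  have hsP1 : 1 ≤ √(P : ℝ) := by rw [← Real.sqrt_one]; exact Real.sqrt_le_sqrt (by linarith)
  have hsP : √(P : ℝ) ≤ √Y := Real.sqrt_le_sqrt hPY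
  have hch : (√(P : ℝ) + (√(P : ℝ))⁻¹) / 2 ≤ ((√Y + (√Y)⁻¹) / 2) := by
    have := add_inv_mono_one hsP1 hsP; linarith
  have hch0 : 0 ≤ (√(P : ℝ) + (√(P : ℝ))⁻¹) / 2 := by positivity
  set t : ℝ := ((Real.log (T / (2 * π)) + 1) / (π * T) + (184 + 30 * Real.log T) / T ^ 2) with ht_def
  have h3 : t * ((√(P : ℝ) + (√(P : ℝ))⁻¹) / 2) ≤ t * ((√Y + (√Y)⁻¹) / 2) := mul_le_mul_of_nonneg_left hch ht0
  have h4 : (1 + 2 / Real.log (P : ℝ)) * (t * ((√(P : ℝ) + (√(P : ℝ))⁻¹) / 2)) ≤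
      (1 + 2 / ((L1 k : ℚ) : ℝ)) * (t * ((√Y + (√Y)⁻¹) / 2)) :=
    mul_le_mul (by linarith) h3 (mul_nonneg ht0 hch0) (by linarith)
  have hbud : 0.0463 + (1 + 2 / Real.log (P : ℝ)) * (t * ((√(P : ℝ) + (√(P : ℝ))⁻¹) / 2)) ≤ ((bkS k : ℚ) : ℝ) := by
    linarith
  have hkey := key_ineq_levelS hB hk11 hk17 hPl hPu hQP hbud
  exact mertens_prod_lt_of hW hP11 hPB hlow hkey

/-- **THE LIFTED, REFLECTED LOW-HEIGHT CA MERTENS LAW below `4¹⁸`** (cells only, top level partial): at any `T ≥ 10⁵` with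
`RH(T)`, the CA Mertens inequality for `4¹¹ ≤ P ≤ X`, `Q ≤ P` (`X < 4¹⁸`), provided every level `4ᵏ ≤ X` (`11 ≤ k ≤ 17`) passes
`0.0463 + (1 + 2/L1 k)·tailH(T)·(√m + 1/√m)/2 ≤ b'_k`, `m = min X 4ᵏ⁺¹`. -/
theorem mertensProdLt_lowSR (hB : Buthe2018_thm2_theta) (hK : BroadbentEtAl2021_theta_rel_1e19)
    {T : ℝ} (hT : 100000 ≤ T) (hRH : RiemannHypothesisUpTo T) {X : ℝ} (hX18 : X < (4 : ℝ) ^ 18)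
    (hcell : ∀ k : ℕ, 11 ≤ k → k ≤ 17 → (4 : ℝ) ^ k ≤ X → 0.0463 + (1 + 2 / ((L1 k : ℚ) : ℝ)) *
      (((Real.log (T / (2 * π)) + 1) / (π * T) + (184 + 30 * Real.log T) / T ^ 2) * ((√(min X ((4 : ℝ) ^ (k + 1))) + (√(min X ((4 : ℝ) ^ (k + 1))))⁻¹) / 2)) ≤
        ((bkS k : ℚ) : ℝ))
    {P Q : ℕ} (hP : 4 ^ 11 ≤ P) (hPX : (P : ℝ) ≤ X) (hQP : Q ≤ P) :
    (∏ p ∈ Nat.primesLE P, (1 - (p : ℝ)⁻¹))⁻¹ *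
        ∏ p ∈ (Nat.primesLE P).filter (fun p => Q < p), (1 - ((p : ℝ) ^ 2)⁻¹) <
      rexp eulerMascheroniConstant * Real.log (θ P + θ Q) := by
  have hP0 : P ≠ 0 := by intro h; rw [h] at hP; norm_num at hP
  have hP18 : P < 4 ^ 18 := by exact_mod_cast (lt_of_le_of_lt hPX hX18 : (P : ℝ) < (4 : ℝ) ^ 18)
  have hPl : 4 ^ Nat.log 4 P ≤ P := Nat.pow_log_le_self 4 hP0
  have hPu : P < 4 ^ (Nat.log 4 P + 1) := Nat.lt_pow_succ_log_self (by norm_num) P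
  have hk11 : 11 ≤ Nat.log 4 P := by
    by_contra h; rw [not_le] at h
    have : 4 ^ (Nat.log 4 P + 1) ≤ 4 ^ 11 := Nat.pow_le_pow_right (by norm_num) (by omega)
    omega
  have hk17 : Nat.log 4 P ≤ 17 := by
    by_contra h; rw [not_le] at h
    have : 4 ^ 18 ≤ 4 ^ Nat.log 4 P := Nat.pow_le_pow_right (by norm_num) (by omega)
    omega
  have hkX : (4 : ℝ) ^ Nat.log 4 P ≤ X := le_trans (by exact_mod_cast hPl) hPX
  have hPY : (P : ℝ) ≤ min X ((4 : ℝ) ^ (Nat.log 4 P + 1)) := le_min hPX (by exact_mod_cast hPu.le)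
  exact mertensProdLt_levelSR hB hK hT hRH hk11 hk17 (hcell _ hk11 hk17 hkX) hPl hPu.le hPY hQP

open scoped ArithmeticFunction.sigma in
/-- **THE LIFTED, REFLECTED LOW-HEIGHT CA-SIDE HEIGHT LAW.  RH verified to ANY height `T ≥ 10⁵` + {Büthe 2018 Thm 2, BKLNW 2021}
⟹ Robin's inequality at every colossally abundant `N > 5040` all of whose primes are `≤ X`**, for every natural `X < 4¹⁸` passing
the reflected lifted level conditions of the levels `≤ X` (top level partial).  No conjecture in hypothesis position. -/
theorem robinCA_below_lowSR (hB : Buthe2018_thm2_theta) (hK : BroadbentEtAl2021_theta_rel_1e19)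
    {T : ℝ} (hT : 100000 ≤ T) (hRH : RiemannHypothesisUpTo T) {X : ℕ} (hX18 : (X : ℝ) < (4 : ℝ) ^ 18)
    (hcell : ∀ k : ℕ, 11 ≤ k → k ≤ 17 → (4 : ℝ) ^ k ≤ (X : ℝ) → 0.0463 + (1 + 2 / ((L1 k : ℚ) : ℝ)) *
      (((Real.log (T / (2 * π)) + 1) / (π * T) + (184 + 30 * Real.log T) / T ^ 2) * ((√(min (X : ℝ) ((4 : ℝ) ^ (k + 1))) + (√(min (X : ℝ) ((4 : ℝ) ^ (k + 1))))⁻¹) / 2)) ≤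
        ((bkS k : ℚ) : ℝ)) :
    robinCA_below (X + 1) := by
  intro N hCA h5040 hprimes
  obtain ⟨ε, P, Q, -, -, hP, hPN, -, hQP, hpf, -, -, hσ, hθ, -⟩ := hCA.exists_structure
  by_cases hsmall : P < 4 ^ 11
  · refine robinCA_below_four_pow_eleven N hCA h5040 fun p hp hpN => lt_of_le_of_lt ?_ hsmall
    have hN0 : N ≠ 0 := by omega
    have : p ∈ N.primeFactors := Nat.mem_primeFactors.2 ⟨hp, hpN, hN0⟩
    rw [hpf] at this
    exact (Nat.mem_primesLE.1 this).1
  · rw [not_lt] at hsmall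
    have hPX : (P : ℝ) ≤ X := by
      have := hprimes P hP hPN
      exact_mod_cast Nat.lt_succ_iff.1 this
    have hlt := mertensProdLt_lowSR hB hK hT hRH hX18 hcell hsmall hPX hQP
    have hN0 : N ≠ 0 := by omega
    have hNpos : (0 : ℝ) < N := by exact_mod_cast Nat.pos_of_ne_zero hN0
    have hθpos : 0 < θ P + θ Q := by
      have h1 : 0 < θ (P : ℝ) := Chebyshev.theta_pos (by exact_mod_cast hP.two_le)
      have h2 : 0 ≤ θ (Q : ℝ) := Chebyshev.theta_nonneg _
      linarith
    have hlog : Real.log (θ P + θ Q) ≤ Real.log (Real.log N) := Real.log_le_log hθpos hθ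
    have hlt' : (σ 1 N : ℝ) / N < rexp eulerMascheroniConstant * Real.log (Real.log N) :=
      lt_of_le_of_lt hσ (hlt.trans_le (mul_le_mul_of_nonneg_left hlog (Real.exp_pos _).le))
    unfold robinInequality
    rw [div_lt_iff₀ hNpos] at hlt'
    linarith

/-- Reflected lifted per-level tail tolerances `2(b'_k − 0.0463)/((1 + 2/L1 k)(2ᵏ⁺¹ + 2⁻ᵏ⁻¹))` rounded down (exact:
`6.9800·10⁻⁵, 6.2265·10⁻⁵, 3.9413·10⁻⁵, 2.2947·10⁻⁵, 1.2742·10⁻⁵, 6.8822·10⁻⁶, 3.6408·10⁻⁶`; lane (ix-h)'s `tolR` on the old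
budgets: about half of these).  A FULL level `k` passes as soon as `tailH(T) ≤ tolSR k`. -/
def tolSR : ℕ → ℚ
  | 11 => 6980 / 10 ^ 8 | 12 => 6226 / 10 ^ 8 | 13 => 3941 / 10 ^ 8 | 14 => 2294 / 10 ^ 8
  | 15 => 12742 / 10 ^ 9 | 16 => 6882 / 10 ^ 9 | 17 => 3640 / 10 ^ 9 | _ => 0

/-- The (full) reflected lifted level condition from the tolerance (`4ᵏ ≤ X` so that `1 ≤ √m ≤ 2ᵏ⁺¹`). -/
theorem levelSR_of_tol {t X : ℝ} {k : ℕ} (hk11 : 11 ≤ k) (hk17 : k ≤ 17) (hX : (4 : ℝ) ^ k ≤ X) (ht0 : 0 ≤ t)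
    (ht : t ≤ ((tolSR k : ℚ) : ℝ)) :
    0.0463 + (1 + 2 / ((L1 k : ℚ) : ℝ)) * (t * ((√(min X ((4 : ℝ) ^ (k + 1))) + (√(min X ((4 : ℝ) ^ (k + 1))))⁻¹) / 2)) ≤ ((bkS k : ℚ) : ℝ) := by
  have hL₁8 := (range_facts (k := k) (by omega)).2.2.2.2.1
  have hm1 : (1 : ℝ) ≤ min X ((4 : ℝ) ^ (k + 1)) :=
    le_min ((one_le_pow₀ (by norm_num : (1 : ℝ) ≤ 4)).trans hX) (one_le_pow₀ (by norm_num))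
  have hs1 : 1 ≤ √(min X ((4 : ℝ) ^ (k + 1))) := by rw [← Real.sqrt_one]; exact Real.sqrt_le_sqrt hm1
  have hs : √(min X ((4 : ℝ) ^ (k + 1))) ≤ 2 ^ (k + 1) := by
    rw [← sqrt_four_pow]; exact Real.sqrt_le_sqrt (min_le_right _ _)
  have hch : ((√(min X ((4 : ℝ) ^ (k + 1))) + (√(min X ((4 : ℝ) ^ (k + 1))))⁻¹) / 2) ≤ ((2 : ℝ) ^ (k + 1) + ((2 : ℝ) ^ (k + 1))⁻¹) / 2 := by
    have := add_inv_mono_one hs1 hs; linarith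
  have hfac0 : (0 : ℝ) ≤ 1 + 2 / ((L1 k : ℚ) : ℝ) := by
    have : (0 : ℝ) ≤ 2 / ((L1 k : ℚ) : ℝ) := div_nonneg (by norm_num) (by linarith)
    linarith
  have h1 : (1 + 2 / ((L1 k : ℚ) : ℝ)) * (t * ((√(min X ((4 : ℝ) ^ (k + 1))) + (√(min X ((4 : ℝ) ^ (k + 1))))⁻¹) / 2)) ≤
      (1 + 2 / ((L1 k : ℚ) : ℝ)) * (t * (((2 : ℝ) ^ (k + 1) + ((2 : ℝ) ^ (k + 1))⁻¹) / 2)) :=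
    mul_le_mul_of_nonneg_left (mul_le_mul_of_nonneg_left hch ht0) hfac0
  have h2 : 0.0463 + (1 + 2 / ((L1 k : ℚ) : ℝ)) * (t * (((2 : ℝ) ^ (k + 1) + ((2 : ℝ) ^ (k + 1))⁻¹) / 2)) ≤ ((bkS k : ℚ) : ℝ) := by
    interval_cases k <;>
      · simp only [tolSR, bkS, L1, l2] at ht ⊢; push_cast at ht ⊢; norm_num at ht ⊢; nlinarith [ht]
  linarith

/-- **Cells-only range at height `T` on the lifted budgets, reflected**: if every level `11 ≤ k ≤ K` (`K ≤ 17`) has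
`tailH(T) ≤ tolSR k`, then Robin holds at every CA number `> 5040` with primes `< 4^{K+1}`. -/
theorem robinCA_below_cellsSR (hB : Buthe2018_thm2_theta) (hK : BroadbentEtAl2021_theta_rel_1e19)
    {T : ℝ} (hT : 100000 ≤ T) (hRH : RiemannHypothesisUpTo T) {K : ℕ} (hK11 : 11 ≤ K) (hK17 : K ≤ 17)
    (htol : ∀ k : ℕ, 11 ≤ k → k ≤ K → ((Real.log (T / (2 * π)) + 1) / (π * T) + (184 + 30 * Real.log T) / T ^ 2) ≤ ((tolSR k : ℚ) : ℝ)) :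
    robinCA_below (4 ^ (K + 1)) := by
  have hT7 : (7 : ℝ) ≤ T := by linarith
  have ht0 := Summit.RiemannHypothesis.RiemannHypothesis.Theorems.Splittings.RobinFiniteTail.tailH_nonneg hT7
  have h1 : 1 ≤ 4 ^ (K + 1) := Nat.one_le_pow _ _ (by norm_num)
  rw [← Nat.sub_add_cancel h1]
  set X : ℕ := 4 ^ (K + 1) - 1 with hX_def
  have hXr : (X : ℝ) = (4 : ℝ) ^ (K + 1) - 1 := by
    rw [hX_def, Nat.cast_sub h1]; push_cast; ring
  have hX18 : (X : ℝ) < (4 : ℝ) ^ 18 := by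
    rw [hXr]; have : (4 : ℝ) ^ (K + 1) ≤ 4 ^ 18 := pow_le_pow_right₀ (by norm_num) (by omega); linarith
  refine robinCA_below_lowSR hB hK hT hRH (X := X) hX18 ?_
  intro k hk11 hk17 hkX
  have hkK : k ≤ K := by
    by_contra h
    rw [not_le] at h
    have : (4 : ℝ) ^ (K + 1) ≤ 4 ^ k := pow_le_pow_right₀ (by norm_num) (by omega)
    rw [hXr] at hkX; linarith
  exact levelSR_of_tol hk11 hk17 hkX ht0 (htol k hk11 hkK)

/-! #### The reflected rows (all with `RH(T)` in hypothesis position; nothing here bears on the truth of RH) -/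

/-- **RH to height `10⁵` — the tree's KERNEL height — ⟹ Robin at every CA number `> 5040` with primes `< 4¹⁴ = 268 435 456`**
(levels 11, 12, 13 in full: `tailH(10⁵) ≤ 3.42·10⁻⁵ ≤ tolSR 13 = 3.94·10⁻⁵`; un-reflected: level 11 only). -/
theorem robinCA_below_of_rh100000SR (hB : Buthe2018_thm2_theta) (hK : BroadbentEtAl2021_theta_rel_1e19)
    {T : ℝ} (hT : 100000 ≤ T) (hRH : RiemannHypothesisUpTo T) : robinCA_below (4 ^ 14) := by
  have hRH' : RiemannHypothesisUpTo 100000 := RiemannHypothesisUpTo.mono_of_le hT hRH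
  have ht := Summit.RiemannHypothesis.RiemannHypothesis.Theorems.Splittings.RobinFiniteTail.tailH_1e5_le
  refine robinCA_below_cellsSR hB hK (T := 100000) le_rfl hRH' (K := 13) (by norm_num) (by norm_num) fun k hk11 hk13 => ?_
  refine ht.trans ?_
  interval_cases k <;> · simp only [tolSR]; push_cast; norm_num

/-- **RH to height `10⁵` ⟹ Robin at every CA number `> 5040` with primes `≤ 4.83·10⁸`** — levels 11–13 in full and the PARTIAL
level 14 up to `X = 483 000 000` (`√X ≤ 21978`, `(s + 1/s)/2 ≤ (21978 + 1)/2`; `0.0463 + 1.10305·3.42·10⁻⁵·10989.5 = 0.46088 ≤ b'₁₄ = 0.461`). -/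
theorem robinCA_below_483e6_of_rh100000R (hB : Buthe2018_thm2_theta) (hK : BroadbentEtAl2021_theta_rel_1e19)
    {T : ℝ} (hT : 100000 ≤ T) (hRH : RiemannHypothesisUpTo T) : robinCA_below (483000000 + 1) := by
  have hRH' : RiemannHypothesisUpTo 100000 := RiemannHypothesisUpTo.mono_of_le hT hRH
  have ht := Summit.RiemannHypothesis.RiemannHypothesis.Theorems.Splittings.RobinFiniteTail.tailH_1e5_le
  have ht0 := Summit.RiemannHypothesis.RiemannHypothesis.Theorems.Splittings.RobinFiniteTail.tailH_nonneg (T := 100000) (by norm_num)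
  refine robinCA_below_lowSR hB hK (T := 100000) le_rfl hRH' (X := 483000000) (by norm_num) ?_
  intro k hk11 hk17 hkX
  have hk14 : k ≤ 14 := by
    by_contra h
    rw [not_le] at h
    have h15 : (1073741824 : ℝ) ≤ (4 : ℝ) ^ k :=
      calc (1073741824 : ℝ) = (4 : ℝ) ^ 15 := by norm_num
        _ ≤ (4 : ℝ) ^ k := pow_le_pow_right₀ (by norm_num) (by omega)
    have hkX' : (4 : ℝ) ^ k ≤ 483000000 := by exact_mod_cast hkX
    linarith
  by_cases hk13 : k ≤ 13
  · refine levelSR_of_tol hk11 hk17 hkX ht0 (ht.trans ?_)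
    interval_cases k <;> · simp only [tolSR]; push_cast; norm_num
  · have hk : k = 14 := by omega
    subst hk
    set t : ℝ := (Real.log (100000 / (2 * π)) + 1) / (π * 100000) + (184 + 30 * Real.log 100000) / 100000 ^ 2 with ht_def
    set s : ℝ := √(min ((483000000 : ℕ) : ℝ) ((4 : ℝ) ^ (14 + 1))) with hs_def
    have hm1 : (1 : ℝ) ≤ min ((483000000 : ℕ) : ℝ) ((4 : ℝ) ^ (14 + 1)) := le_min (by norm_num) (by norm_num)
    have hs1 : 1 ≤ s := by rw [hs_def, ← Real.sqrt_one]; exact Real.sqrt_le_sqrt hm1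
    have hs : s ≤ 21978 := by
      rw [hs_def]
      refine (Real.sqrt_le_sqrt (min_le_left _ _)).trans ?_
      calc √((483000000 : ℕ) : ℝ) ≤ √((21978 : ℝ) ^ 2) := Real.sqrt_le_sqrt (by norm_num)
        _ = 21978 := Real.sqrt_sq (by norm_num)
    have hinv : s⁻¹ ≤ 1 := inv_le_one_of_one_le₀ hs1
    have hinv0 : 0 ≤ s⁻¹ := inv_nonneg.mpr (by linarith)
    have hch : (s + s⁻¹) / 2 ≤ 10989.5 := by linarith
    have hch0 : (0 : ℝ) ≤ (s + s⁻¹) / 2 := by linarith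
    have hprod : t * ((s + s⁻¹) / 2) ≤ 3.42e-5 * 10989.5 := mul_le_mul ht hch hch0 (by norm_num)
    have hts0 : 0 ≤ t * ((s + s⁻¹) / 2) := mul_nonneg ht0 hch0
    have hfac : 1 + 2 / ((L1 14 : ℚ) : ℝ) ≤ 1.10305 := by simp only [L1, l2]; push_cast; norm_num
    have hfac0 : (0 : ℝ) ≤ 1 + 2 / ((L1 14 : ℚ) : ℝ) := by simp only [L1, l2]; push_cast; norm_num
    have key := mul_le_mul hfac hprod hts0 (by norm_num)
    have hb : ((bkS 14 : ℚ) : ℝ) = 0.461 := by simp only [bkS]; push_cast; norm_num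
    rw [hb]; linarith

/-- **RH to height `10⁵` + {Büthe 2018 Thm 2, BKLNW 2021} ⟹ Robin's inequality for every `5040 < n` with
`log n ≤ 0.99947·(4.83·10⁸ − 1)`, i.e. up to about `10^(2.096·10⁸)`** (`robin_all_of_robinCA_below_low`). -/
theorem robin_le_of_rh100000SR (hB : Buthe2018_thm2_theta) (hK : BroadbentEtAl2021_theta_rel_1e19)
    {T : ℝ} (hT : 100000 ≤ T) (hRH : RiemannHypothesisUpTo T) :
    ∀ n : ℕ, 5040 < n → Real.log n ≤ 0.99947 * ((483000000 : ℝ) - 1) → robinInequality n := by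
  have h := robin_all_of_robinCA_below_low hB hK (robinCA_below_483e6_of_rh100000R hB hK hT hRH) (by norm_num)
  intro n hn hlog
  exact h n hn (by exact_mod_cast hlog)

/-- **All-integer currency, reflected: RH to height `10⁵` + the two print `θ`-facts ⟹ Robin's inequality for every
`5040 < n ≤ 10^209 600 000`** (`209 600 000·log 10 ≤ 482 621 836 ≤ 0.99947·482 999 999`). -/
theorem robin_le_ten_pow_of_rh100000SR (hB : Buthe2018_thm2_theta) (hK : BroadbentEtAl2021_theta_rel_1e19)
    {T : ℝ} (hT : 100000 ≤ T) (hRH : RiemannHypothesisUpTo T) :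
    ∀ n : ℕ, 5040 < n → n ≤ 10 ^ 209600000 → robinInequality n := by
  intro n hn hle
  have hn0 : 0 < n := lt_of_le_of_lt (Nat.zero_le 5040) hn
  have h1 : Real.log n ≤ ((209600000 : ℕ) : ℝ) * Real.log 10 := log_le_of_le_ten_pow hn0 hle
  clear hle
  refine robin_le_of_rh100000SR hB hK hT hRH n hn ?_
  have h10 := RobinAnalytic.log_ten_lt
  have h9 : ((209600000 : ℕ) : ℝ) = 209600000 := by norm_num
  rw [h9] at h1
  nlinarith

/-- **RH to height `181 000` ⟹ Robin at CA numbers with primes `< 4¹⁵ = 1 073 741 824`** (`13/(π·181000) = 2.286·10⁻⁵ ≤ tolSR 14`;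
lane (ix-h) on the old budgets: `RH(330 000)`; un-reflected lifted: `RH(364 000)`; tree: `RH(500 000)`). -/
theorem robinCA_below_of_rh181000SR (hB : Buthe2018_thm2_theta) (hK : BroadbentEtAl2021_theta_rel_1e19)
    {T : ℝ} (hT : 181000 ≤ T) (hRH : RiemannHypothesisUpTo T) : robinCA_below (4 ^ 15) := by
  have hπ := Real.pi_gt_d6
  refine robinCA_below_cellsSR hB hK (by linarith) hRH (K := 14) (by norm_num) (by norm_num) fun k hk11 hk13 => ?_
  refine (tailH_le_of_height (n := 13) (by norm_num) (by norm_num) hT).trans ?_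
  rw [div_le_iff₀ (by positivity)]
  interval_cases k <;> · simp only [tolSR]; push_cast; nlinarith

/-- **RH to height `325 000` ⟹ Robin at CA numbers with primes `< 4¹⁶ = 4 294 967 296`** (`13/(π·325000) = 1.2732·10⁻⁵ ≤ tolSR 15`;
(ix-h): `RH(500 000)`; un-reflected lifted: `RH(705 000)`; tree: `RH(860 000)`). -/
theorem robinCA_below_of_rh325000SR (hB : Buthe2018_thm2_theta) (hK : BroadbentEtAl2021_theta_rel_1e19)
    {T : ℝ} (hT : 325000 ≤ T) (hRH : RiemannHypothesisUpTo T) : robinCA_below (4 ^ 16) := by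
  have hπ := Real.pi_gt_d6
  refine robinCA_below_cellsSR hB hK (by linarith) hRH (K := 15) (by norm_num) (by norm_num) fun k hk11 hk13 => ?_
  refine (tailH_le_of_height (n := 13) (by norm_num) (by norm_num) hT).trans ?_
  rw [div_le_iff₀ (by positivity)]
  interval_cases k <;> · simp only [tolSR]; push_cast; nlinarith

/-- **RH to height `648 000` ⟹ Robin at CA numbers with primes `< 4¹⁷ = 17 179 869 184`** (`14/(π·648000) = 6.877·10⁻⁶ ≤ tolSR 16`;
(ix-h): `RH(860 000)`; un-reflected lifted: `RH(1 400 000)`; tree: `RH(1 620 000)`). -/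
theorem robinCA_below_of_rh648000SR (hB : Buthe2018_thm2_theta) (hK : BroadbentEtAl2021_theta_rel_1e19)
    {T : ℝ} (hT : 648000 ≤ T) (hRH : RiemannHypothesisUpTo T) : robinCA_below (4 ^ 17) := by
  have hπ := Real.pi_gt_d6
  refine robinCA_below_cellsSR hB hK (by linarith) hRH (K := 16) (by norm_num) (by norm_num) fun k hk11 hk13 => ?_
  refine (tailH_le_of_height (n := 14) (by norm_num) (by norm_num) hT).trans ?_
  rw [div_le_iff₀ (by positivity)]
  interval_cases k <;> · simp only [tolSR]; push_cast; nlinarith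

/-- **RH to height `1 320 000` ⟹ Robin at CA numbers with primes `< 4¹⁸ = 68 719 476 736`** (`15/(π·1.32·10⁶) = 3.617·10⁻⁶ ≤ tolSR 17`;
(ix-h): `RH(1 620 000)`; un-reflected lifted: `RH(2 650 000)`; tree: `RH(3 000 000)`). -/
theorem robinCA_below_of_rh1320000SR (hB : Buthe2018_thm2_theta) (hK : BroadbentEtAl2021_theta_rel_1e19)
    {T : ℝ} (hT : 1320000 ≤ T) (hRH : RiemannHypothesisUpTo T) : robinCA_below (4 ^ 18) := by
  have hπ := Real.pi_gt_d6
  refine robinCA_below_cellsSR hB hK (by linarith) hRH (K := 17) (by norm_num) le_rfl fun k hk11 hk13 => ?_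
  refine (tailH_le_of_height (n := 15) (by norm_num) (by norm_num) hT).trans ?_
  rw [div_le_iff₀ (by positivity)]
  interval_cases k <;> · simp only [tolSR]; push_cast; nlinarith

end SqrtWindowRefl

end Summit.RiemannHypothesis.RiemannHypothesis.Theorems.Splittings.RobinFiniteC1

/-! ### Standard-axiom guards (RH(T) in hypothesis position; no kernel certificate is imported by this file) -/

/-- info: 'Summit.RiemannHypothesis.RiemannHypothesis.Theorems.Splittings.RobinFiniteC1.robinCA_below_483e6_of_rh100000R' depends on axioms: [propext, Classical.choice, Quot.sound] -/
#guard_msgs (whitespace := lax) in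
#print axioms Summit.RiemannHypothesis.RiemannHypothesis.Theorems.Splittings.RobinFiniteC1.robinCA_below_483e6_of_rh100000R

/-- info: 'Summit.RiemannHypothesis.RiemannHypothesis.Theorems.Splittings.RobinFiniteC1.robin_le_ten_pow_of_rh100000SR' depends on axioms: [propext, Classical.choice, Quot.sound] -/
#guard_msgs (whitespace := lax) in
#print axioms Summit.RiemannHypothesis.RiemannHypothesis.Theorems.Splittings.RobinFiniteC1.robin_le_ten_pow_of_rh100000SR

/-- info: 'Summit.RiemannHypothesis.RiemannHypothesis.Theorems.Splittings.RobinFiniteC1.robinCA_below_of_rh1320000SR' depends on axioms: [propext, Classical.choice, Quot.sound] -/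
#guard_msgs (whitespace := lax) in
#print axioms Summit.RiemannHypothesis.RiemannHypothesis.Theorems.Splittings.RobinFiniteC1.robinCA_below_of_rh1320000SR

end
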